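import Mathlib.MeasureTheory.Measure.Haar.InnerProductSpace
import Mathlib.MeasureTheory.Integral.Bochner.Basic
import Mathlib.Analysis.Calculus.FDeriv.Symmetric
import Mathlib.LinearAlgebra.Matrix.PosDef
import HarnessLib

/-!
# S2-COORD: orthonormal coordinates for the chart-side fibre integral — `∫_Y G = ∫_{ι → ℝ} G(Σ xᵢ bᵢ)`, a bilinear (Hessian) letter `B y y` IS the quadratic form
# `x ⬝ᵥ (H *ᵥ x)` of the matrix `H i j := B (b i) (b j)`, and HESS-POS (`∀ y ≠ 0, 0 < B y y`) + symmetry make `H` POSITIVE DEFINITE (GREP's covariance `C := H⁻¹`)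

Cell `ym3-torus` (YM ladder rung R3 = continuum `SU(2)` Yang–Mills on the three-torus — a RUNG, NOT d = 4, NOT infinite volume, NOT a mass gap, NOT Clay).
Width seat `ym3-torus-px20` (gen 16); `--supports stmt-QuantumFields-20520 --as helper`, count-neutral, definition-free, default heartbeats; registry v11.4 №36
untouched.  The junction between two currencies of the crux `FluctuationComparisonRegPrIntL` (stmt-QuantumFields-20520): the S2β (T)-chain states the Hessian of the action
through a chart `Ψ : Y → fields` on an ABSTRACT finite-dimensional real inner-product space `Y` as the letter `fderiv ℝ (fderiv ℝ (A ∘ Ψ)) 0 y y` (HESS-POS = `∀ y ≠ 0, 0 < …`,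
✓`…S2BetaTubeGrowthOfHessianPos`, ✓`…S2BetaFlatSecondVariationAlongCurve.hessPos_flat_of_transversal`), while GREP (✓`AnchorGap.stub_gaussianBBFPolymerRep`) and the
S2-GAUSS door (`…LoopLedgerGaussianScaling`) live on `ι → ℝ` with a positive definite covariance MATRIX.  This file is the dictionary, generic and Mathlib-only:
* §1 ★`integral_comp_orthonormalBasis (b : OrthonormalBasis ι ℝ Y) (G) : ∫ x : ι → ℝ, G (∑ i, x i • b i) = ∫ y, G y` — orthonormal coordinates carry the inner-product-space
  volume to Lebesgue measure on `ι → ℝ` (Mathlib `OrthonormalBasis.measurePreserving_repr_symm` ∘ `PiLp.volume_preserving_toLp`), for EVERY `G`.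
* §2 `bilin_sum_smul_sum_smul` (`B (Σ xᵢbᵢ) (Σ zⱼbⱼ) = x ⬝ᵥ (H *ᵥ z)`, `H := Matrix.of fun i j => B (b i) (b j)`, any family `b`), `isHermitian_of_symm`, ★★`posDef_of_pos_of_symm`
  (`(∀ y z, B y z = B z y) → (∀ y ≠ 0, 0 < B y y) → H.PosDef` for a linearly independent family — in particular an orthonormal basis), `posDef_of_pos_of_symm_orthonormalBasis`.
* §3 the Hessian letter: `isSymm_fderiv_fderiv_of_contDiffAt` (`ContDiffAt ℝ 2 g 0 ⇒ D²g(0) y z = D²g(0) z y`, Mathlib `ContDiffAt.isSymmSndFDerivAt`), ★★`posDef_hessMatrix_of_hessPos`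
  (`ContDiffAt ℝ 2 g 0`, HESS-POS ⇒ `(Matrix.of fun i j => fderiv ℝ (fderiv ℝ g) 0 (b i) (b j)).PosDef`), `hess_quadForm_eq` (`D²g(0) (Σxᵢbᵢ) (Σxᵢbᵢ) = x ⬝ᵥ (H *ᵥ x)`).

HONEST SCOPE.  [folklore] linear algebra and the change of variables to orthonormal coordinates; nothing of HESS-POS itself, of the chart, of GREP's hypotheses, of Bałaban's
expansions, of GAS∕GAS₁∕REP∕H4ᶜ∕S2β or of `FluctuationComparisonRegPrIntL` (stmt-QuantumFields-20520) is proved; no summit statement is proved by a helper; rung R3 = SU(2) YM₃ on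
T³ — NOT d = 4, NOT infinite volume, NOT a mass gap, NOT Clay; the Yang–Mills mass gap is NOT proved.

References: T. Bałaban, CMP **102** (1985) 255–275 [Balaban1985UV3] ((45)–(47)); J. Glimm, A. Jaffe, *Quantum Physics* (1987) §9.1 [GlimmJaffe1987].
-/

set_option autoImplicit false

noncomputable section

open MeasureTheory Matrix
open scoped Real

namespace Summit.QuantumFields.YangMills.Theorems.LoopLedgerHessianCoordinates

variable {ι : Type*} [Fintype ι]

section Coordinates

variable {Y : Type*} [NormedAddCommGroup Y] [InnerProductSpace ℝ Y]

/-! ## §1 Orthonormal coordinates and the volume -/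

/-- the coordinate map of an orthonormal basis, read on `ι → ℝ`: `b.repr.symm (toLp x) = Σ xᵢ bᵢ`. [folklore] -/
theorem repr_symm_toLp_eq_sum (b : OrthonormalBasis ι ℝ Y) (x : ι → ℝ) :
    b.repr.symm (WithLp.toLp 2 x) = ∑ i, x i • b i := by
  rw [← OrthonormalBasis.sum_repr_symm]

/-- ★ **orthonormal coordinates carry the volume of `Y` to Lebesgue measure on `ι → ℝ`**: `∫ x, G(Σ xᵢ bᵢ) dx = ∫ y, G y` for EVERY `G : Y → ℝ` (junk values included).
[folklore] -/
theorem integral_comp_orthonormalBasis [FiniteDimensional ℝ Y] [MeasurableSpace Y] [BorelSpace Y] (b : OrthonormalBasis ι ℝ Y) (G : Y → ℝ) :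
    ∫ x : ι → ℝ, G (∑ i, x i • b i) = ∫ y, G y := by
  have h : MeasurePreserving (fun x : ι → ℝ => b.repr.symm (WithLp.toLp 2 x)) volume volume :=
    b.measurePreserving_repr_symm.comp (PiLp.volume_preserving_toLp ι)
  have hemb : MeasurableEmbedding (fun x : ι → ℝ => b.repr.symm (WithLp.toLp 2 x)) :=
    (b.repr.symm.toHomeomorph.toMeasurableEquiv.measurableEmbedding).comp (MeasurableEquiv.toLp 2 (ι → ℝ)).measurableEmbedding
  rw [← h.integral_comp hemb]
  simp_rw [repr_symm_toLp_eq_sum]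

end Coordinates

section Bilinear

variable {Y : Type*} [NormedAddCommGroup Y] [NormedSpace ℝ Y]

/-! ## §2 A bilinear letter in coordinates -/

/-- `B (Σ xᵢbᵢ) (Σ zⱼbⱼ) = x ⬝ᵥ (H *ᵥ z)` with `H i j := B (b i) (b j)` (any family `b`, any continuous bilinear `B`). [folklore] -/
theorem bilin_sum_smul_sum_smul (B : Y →L[ℝ] Y →L[ℝ] ℝ) (b : ι → Y) (x z : ι → ℝ) :
    B (∑ i, x i • b i) (∑ j, z j • b j) = x ⬝ᵥ ((Matrix.of fun i j => B (b i) (b j)) *ᵥ z) := by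
  simp only [map_sum, map_smul, FunLike.coe_sum, FunLike.coe_smul, Finset.sum_apply, Pi.smul_apply, smul_eq_mul, dotProduct,
    Matrix.mulVec, Matrix.of_apply, Finset.mul_sum]
  rw [Finset.sum_comm]
  exact Finset.sum_congr rfl fun i _ => Finset.sum_congr rfl fun j _ => by ring

omit [Fintype ι] in
/-- a symmetric letter gives a symmetric (Hermitian) matrix. [folklore] -/
theorem isHermitian_of_symm (B : Y →L[ℝ] Y →L[ℝ] ℝ) (b : ι → Y) (hsymm : ∀ y z, B y z = B z y) :
    (Matrix.of fun i j => B (b i) (b j)).IsHermitian := by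
  ext i j
  simp only [conjTranspose_apply, of_apply, star_trivial]
  exact hsymm _ _

/-- ★★ **HESS-POS ⇒ positive definite matrix**: a symmetric letter `B` with `B y y > 0` for `y ≠ 0`, read in a LINEARLY INDEPENDENT family `b`, has a positive definite matrix
`H i j := B (b i) (b j)` (so GREP's covariance `C := H⁻¹` is positive definite by `Matrix.PosDef.inv`). [folklore] -/
theorem posDef_of_pos_of_symm (B : Y →L[ℝ] Y →L[ℝ] ℝ) {b : ι → Y} (hb : LinearIndependent ℝ b)
    (hsymm : ∀ y z, B y z = B z y) (hpos : ∀ y, y ≠ 0 → 0 < B y y) :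
    (Matrix.of fun i j => B (b i) (b j)).PosDef := by
  refine Matrix.PosDef.of_dotProduct_mulVec_pos (isHermitian_of_symm B b hsymm) fun x hx => ?_
  rw [star_trivial, ← bilin_sum_smul_sum_smul]
  refine hpos _ fun h => hx ?_
  exact linearIndependent_iff'.1 hb Finset.univ x h |> fun hi => funext fun i => hi i (Finset.mem_univ i)

/-- the same for an orthonormal basis (the coordinates of §1). [folklore] -/
theorem posDef_of_pos_of_symm_orthonormalBasis {Y : Type*} [NormedAddCommGroup Y] [InnerProductSpace ℝ Y] (B : Y →L[ℝ] Y →L[ℝ] ℝ) (b : OrthonormalBasis ι ℝ Y)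
    (hsymm : ∀ y z, B y z = B z y) (hpos : ∀ y, y ≠ 0 → 0 < B y y) :
    (Matrix.of fun i j => B (b i) (b j)).PosDef :=
  posDef_of_pos_of_symm B b.toBasis.linearIndependent hsymm hpos

/-! ## §3 The Hessian letter `fderiv ℝ (fderiv ℝ g) 0` -/

/-- the second derivative of a `C²` function is a symmetric letter (Mathlib `ContDiffAt.isSymmSndFDerivAt` over `ℝ`). [folklore] -/
theorem isSymm_fderiv_fderiv_of_contDiffAt {g : Y → ℝ} {y₀ : Y} (hg : ContDiffAt ℝ 2 g y₀) (y z : Y) :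
    fderiv ℝ (fderiv ℝ g) y₀ y z = fderiv ℝ (fderiv ℝ g) y₀ z y :=
  hg.isSymmSndFDerivAt (by simp) y z

/-- ★★ **the Hessian MATRIX of a `C²` function at a HESS-POS point is positive definite**: `ContDiffAt ℝ 2 g y₀` and `∀ y ≠ 0, 0 < D²g(y₀) y y` give
`(Matrix.of fun i j => D²g(y₀) (b i) (b j)).PosDef` in any orthonormal basis `b` — the (T)-chain's `hH` letter turned into GREP's `C.PosDef` (at `C := H⁻¹`). [folklore] -/
theorem posDef_hessMatrix_of_hessPos {Y : Type*} [NormedAddCommGroup Y] [InnerProductSpace ℝ Y] {g : Y → ℝ} {y₀ : Y} (hg : ContDiffAt ℝ 2 g y₀) (b : OrthonormalBasis ι ℝ Y)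
    (hH : ∀ y, y ≠ 0 → 0 < fderiv ℝ (fderiv ℝ g) y₀ y y) :
    (Matrix.of fun i j => fderiv ℝ (fderiv ℝ g) y₀ (b i) (b j)).PosDef :=
  posDef_of_pos_of_symm_orthonormalBasis (fderiv ℝ (fderiv ℝ g) y₀) b (isSymm_fderiv_fderiv_of_contDiffAt hg) hH

/-- the Hessian letter in coordinates: `D²g(y₀) (Σxᵢbᵢ) (Σxᵢbᵢ) = x ⬝ᵥ (H *ᵥ x)`, `H i j := D²g(y₀) (b i) (b j)`. [folklore] -/
theorem hess_quadForm_eq (g : Y → ℝ) (y₀ : Y) (b : ι → Y) (x : ι → ℝ) :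
    fderiv ℝ (fderiv ℝ g) y₀ (∑ i, x i • b i) (∑ i, x i • b i)
      = x ⬝ᵥ ((Matrix.of fun i j => fderiv ℝ (fderiv ℝ g) y₀ (b i) (b j)) *ᵥ x) :=
  bilin_sum_smul_sum_smul _ b x x

end Bilinear

end Summit.QuantumFields.YangMills.Theorems.LoopLedgerHessianCoordinates

end
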